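import Mathlib
import HarnessLib
import Summits.HubbardSuperconductivity.HubbardSuperconductivity.Theorems.KLProgrammeKLRegimeKernelNormsLevelsTracks

/-!
# Route `KLProgramme` — crux K3 ENGINE (stmt-HubbardSuperconductivity-20437 `KLRegimeEngineV17F2`), stub (b) v2, THE LEVELS PACKAGE (ℓ), read-out (I6)/(I7):
# «(ℓ)-RO5-FLOOR-TRACKS» — `KernelNormsLevels` at a level `j` from the FLOOR READ-OUT on the tracks `t = 0, 2, 4` (`7 ≤ 2p + t`, `p ≤ D`) plus the ONE
# six-leg one-level cell row `(p, t) = (3, 0)` (cell gate-hubbard-kl, seat p4 g20; «(ℓ)-READOUT-F» piece RO-5, p4 lineage — the closer's entry point)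

The floor-keyed read-out (RO-4, k3c3-p2 g16) delivers, per track `t : Fin 5` (level count `F = t + 1`), degree `3 ≤ p ≤ D` with `7 ≤ 2p + t`, and prescription
`Ωe` of exactly `t + 1` legs at the read-out family `F_j`, the clause `‖𝒱_j‖_{Ωe} ≤ CE^p·ε_j^{p−1}·2^{(3p−5)j}·(2^{−j})^{levelGainExp (t+1)}` (law × floor unit
under the threshold `CE ≥ (Q·ε_x²)·B·max 1 (A/ε_x)`, `law_mul_klLevUnitF_le_levelsRHS`).  By «(ℓ)-RO5-TRACKS» only the tracks `t = 0, 2, 4` are needed, and by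
«(ℓ)-RO5-DEGREE-CAP» only `p ≤ D`; the single entry the floor law cannot carry is `(p, t) = (3, 0)` (six legs, one prescribed leg, no gain: the marginal
cell, floor exponent `e_F = p + t − gain − 3 = 0`), which is read from the cell row.  **`kernelNormsLevels_of_floorTracks`** packages exactly this:
floor read-out on `t ∈ {0, 2, 4}` + the six-leg cell clause `‖𝒱_j‖_{Ωe} ≤ CE³·ε_j²·2^{4j}` (`levelCount Ωe = 1`) + `card (HubbardFieldIdx L M) ≤ 2D + 1`, `3 ≤ D`
⇒ `KernelNormsLevels L M P Q β U μ K j`.  Pure bookkeeping; nothing about the model is asserted; nothing asserts (ℓ), any stub, K3 or superconductivity.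
References: BGM 2006 §2.8 (2.76)–(2.77), Lemma 2.5 (2.98), §3 (3.2)–(3.8) [cite: BenfattoGiulianiMastropietro2006].
-/

noncomputable section

namespace Summit.HubbardSuperconductivity.HubbardSuperconductivity.Theorems.KLRegimeSplit

set_option linter.dupNamespace false -- summit = problem name (single-conjunct summit), D-0017

open Classical
open Real Finset Literature.MathematicalPhysics.QuantumLattice Literature.Probability.LatticeModels
open Summit.HubbardSuperconductivity.HubbardSuperconductivity.Theorems.KLProgrammeLegKernels
open Summit.HubbardSuperconductivity.HubbardSuperconductivity.Theorems.KLRegimeWick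

variable {L M : ℕ} [NeZero L]

/-- **`KernelNormsLevels` AT A READ-OUT LEVEL FROM THE FLOOR TRACKS `t = 0, 2, 4` AND THE SIX-LEG CELL** («(ℓ)-RO5-FLOOR-TRACKS», the RO-5 closer's entry
point): if `0 ≤ β`, `0 ≤ Q.CE`, `0 ≤ P.Klam`, `3 ≤ D`, `card (HubbardFieldIdx L M) ≤ 2·D + 1`, the floor read-out clause holds on the tracks `t ∈ {0, 2, 4}` for
`3 ≤ p ≤ D`, `7 ≤ 2p + t` at every prescription of exactly `t + 1` legs, and the six-leg one-level cell clause `‖𝒱_j‖_{Ωe} ≤ CE³·ε_j²·2^{4j}` holds at every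
prescription of exactly one of the six legs, then `KernelNormsLevels L M P Q β U μ K j`. [cite: BenfattoGiulianiMastropietro2006, Lemma 2.5 (2.98)] -/
theorem kernelNormsLevels_of_floorTracks {β : ℝ} (hβ : 0 ≤ β) {U μ : ℝ} {K : TrigPolyC4v} {j : ℕ} {P : SplitConsts} {Q : EngConsts}
    (hCE : 0 ≤ Q.CE) (hK : 0 ≤ P.Klam) {D : ℕ} (hD3 : 3 ≤ D) (hD : Fintype.card (HubbardFieldIdx L M) ≤ 2 * D + 1)
    (hRO : ∀ t : Fin 5, ((t : ℕ) = 0 ∨ (t : ℕ) = 2 ∨ (t : ℕ) = 4) → ∀ p : ℕ, 3 ≤ p → p ≤ D → 7 ≤ 2 * p + t →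
      ∀ Ωe : Fin (2 * p) → Option (SectorLeg (sectorCount j)), levelCount Ωe = (t : ℕ) + 1 →
        klAnisoLegKernelNormAt L M β U μ K klE0 j (2 * p) Ωe ≤
          Q.CE ^ p * (epsCoupling P U j) ^ (p - 1) * (2 : ℝ) ^ ((3 * (p : ℤ) - 5) * j) * (((2 : ℝ) ^ j)⁻¹) ^ levelGainExp ((t : ℕ) + 1))
    (hsix : ∀ Ωe : Fin (2 * 3) → Option (SectorLeg (sectorCount j)), levelCount Ωe = 1 →
      klAnisoLegKernelNormAt L M β U μ K klE0 j (2 * 3) Ωe ≤ Q.CE ^ 3 * (epsCoupling P U j) ^ 2 * (2 : ℝ) ^ ((4 : ℤ) * j)) :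
    KernelNormsLevels L M P Q β U μ K j := by
  have _hD3 := hD3
  refine kernelNormsLevels_of_tracks_capped hβ hCE hK hD fun p hp hpD c e hce Ωe hc => ?_
  rcases hce with ⟨rfl, rfl⟩ | ⟨rfl, rfl⟩ | ⟨rfl, rfl⟩
  · -- one prescribed leg, no gain: the six-leg cell at `p = 3`, the floor track `t = 0` from `p ≥ 4` on
    by_cases hp3 : p = 3
    · subst hp3
      have h := hsix Ωe hc
      have h4 : (2 : ℝ) ^ ((3 * ((3 : ℕ) : ℤ) - 5) * j) = (2 : ℝ) ^ ((4 : ℤ) * j) := by norm_num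
      rw [pow_zero, mul_one, h4]
      simpa using h
    · have h := hRO 0 (by simp) p hp hpD (by simp; omega) Ωe (by simpa using hc)
      have h0 : levelGainExp (((0 : Fin 5) : ℕ) + 1) = 0 := by decide
      rwa [h0] at h
  · have h := hRO 2 (by simp) p hp hpD (by simp; omega) Ωe (by simpa using hc)
    have h1 : levelGainExp (((2 : Fin 5) : ℕ) + 1) = 1 := by decide
    rwa [h1] at h
  · have h := hRO 4 (by simp) p hp hpD (by simp; omega) Ωe (by simpa using hc)
    have h2 : levelGainExp (((4 : Fin 5) : ℕ) + 1) = 2 := by decide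
    rwa [h2] at h

end Summit.HubbardSuperconductivity.HubbardSuperconductivity.Theorems.KLRegimeSplit

end
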